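import Literature.NumberTheory.QuadraticFields.ZsqrtdFormClassGroupProofs
import Literature.NumberTheory.QuadraticFields.PrincipalGenusTheorem
import Literature.NumberTheory.QuadraticFields.OneClassPerGenusPrimes
import Literature.NumberTheory.QuadraticFields.ConvenientNumbers
import Literature.NumberTheory.EllipticCurves.QuadraticOrderPlace
import HarnessLib

/-!
# Venture HSemireg — the LINE LAW's principal-ideal criterion and its PRINCIPAL-GENUS CAPTURE step, kernel-checked
# against the tree's form ∕ ideal dictionary for `ℤ[√m]` (ENGINE-W code B, card LINE-LAW-B.md §7 ∕ §10 ∕ §11)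

HONEST FRAMING. Lean index of the computation cell `pub-hsemireg`, widening group ENGINE-W (code B = the independent second
code, seat `engine-w-2`, gen 11). ARITHMETIC of the order `ℤ[√m]` (Mathlib's `ℤ√m`) and of binary quadratic forms of
discriminant `4m`, using ONLY the tree's Literature (`ZsqrtdFormClassGroupProofs` — Cox Thm. 7.7 for `ℤ[√d]`;
`FormGenus` ∕ `PrincipalGenusTheorem` ∕ `ClassGroupExponentTwoCriteria` — genus theory, Cox §2.C–§3.C; `OneClassPerGenusPrimes` —
`h(-20) = 2`; `ConvenientNumbers` — Euler's 65 numbers and the ambiguity test). Factorwise words, THEOREM CF⁶ and «reached weight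
lines» enter BY VALUE (docstrings). No abelian variety, sheaf, `Ext` group or semiregularity map is constructed; nothing here says that HC, HC_CM or HC_AV holds. Theorems only (0 `def`,
0 named fact, 0 `sorry`). It complements `NestedWeightDivisibility.lean` (card §11, element level: "WHAT IS NOT HERE: ideals ∕
class groups (the PROPOSITION's «iff» and the Pic formulation)") — that «iff» and the class-group step are exactly what is here.

SOURCE STATEMENTS (card `widen/ENGINE-W/out/probe4/LINE-LAW-B.md` v1.8, engine-w-2 g10∕g11, 2026-08-25; REF-W read
`widen/REF-W/REFW-READ-ENGINEW-25.md`). Ground truth (THEOREM CF⁶, by value): a coordinate weight line `(c_j)` is reached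
factorwise from split with node field `ℚ(√m)` iff there are `T > 0`, primitive `z_j ∈ ℤ[√m]` with `N z_j = T∕c_j` and ONE
integer `A` with `z_j ∣ A − l` for all `j` (`l = √m`, `A − l = ⟨A, −1⟩`).
* §11 PROPOSITION (ideal form of the criterion). For `n ∣ A² − m` put `𝔞_n(A) := (n, A − l) = (n, −A + l)`. Then
  «some `z` with `N z = ±n` divides `A − l`» ⟺ «`𝔞_n(A) = (z)`», and such a `z` is automatically primitive.
* §7 THEOREM, Step 1 (a common square root): a primitive representation `n = x² − m y²` makes `m` a square mod `n`;
  roots modulo coprime moduli glue (CRT). Steps 2–4 (the capture): if the primitive forms of discriminant `4m` have ONE CLASS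
  PER GENUS, the ideal `𝔞_n(A)` — whose form `(n, 2A, (A² − m)∕n)` lies in the principal genus as soon as `n` is a value of the
  principal form prime to `4m` — is principal, so a `z` with `N z = n`, `z ∣ A − l` exists FOR THE GIVEN `A`: no coupling.

WHAT THE KERNEL HOLDS (all `m`; the capture for `m < 0` and `n` prime to `4m`):
* §1 `root_identity`, `isCoprime_norm_im`, `exists_root_of_primitive_rep` (`gcd(x,y) = 1 ⇒ x² − m y² ∣ A² − m` for an explicit
  `A`), `crt_pair`, `root_of_congr`, `root_glue` (coprime CRT for roots of `m`), `common_A_of_coprime` (element level: divisors of `A₁ − l`, `A₂ − l` with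
  coprime norms divide a common `A − l` — the class group only couples weights through SHARED primes).
* §2 `re_add_mul_im_of_dvd`, `isCoprime_of_dvd` (a divisor of `A − l` is primitive), `norm_eq_of_mem`,
  **`dvd_and_norm_of_span_eq`** (`(n, −A + l) = (z)` ⇒ `z ∣ A − l ∧ N z = ±n`), **`span_eq_of_dvd_of_norm`** (converse),
  **`span_eq_iff`** — the §11 PROPOSITION — and `exists_span_singleton_of_coe_isPrincipal` (descent of principality from the
  fractional ideal, any domain).
* §3 (`m < 0`) `lineForm_isPosPrim`, `lineForm_genus_eq_one`, `ideal_lineForm`, `one_four_mul`, **`capture_of_forall_genus`**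
  (one class per genus stated on forms, Cox Thm. 3.22 (i)), **`capture`** (stated by the printed class-number criterion
  `h(4m) = 2^{μ−1}`, Thm. 3.22 (v), via the tree's `forall_sq_eq_one_iff_classNumber_eq` and
  `forall_genus_eq_imp_properEquiv_iff_forall_sq_eq_one`), **`capture_of_forall_ambiguous`** (Thm. 3.22 (ii), the decidable test),
  `euler_forall_ambiguous` + **`capture_euler`** (UNCONDITIONAL for all 65 of Euler's convenient numbers `k`, `m = −k`: every imaginary
  one-class-per-genus field of the census), `line_capture` (a whole weight line at once, common `A` given), and the named instance
  **`capture_sqrt_neg_five`** (`ℤ[√−5]`, `h(−20) = 2`, the node field of Q-16-2 ∕ OBSERVATION 16-4).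
WHAT IS NOT HERE: the prime-power refinement of Step 1 for non-coprime moduli; the ramified ∕ even `n` (Step 3's stripping of
ramified primes — REF-W read §A; the conductor-2 bookkeeping of §10); real `m` (narrow classes); THEOREM CF⁶ itself. Tier:
kernel, for the coprime-to-`4m` imaginary case of a hand ×2-across-seats theorem; census ×2 across codes (PROBE5 §16 v6.6b∕c∕i).
-/

open scoped nonZeroDivisors

namespace Summit.Ventures.HSemireg.LineLawPrincipalGenus

open Literature.NumberTheory.QuadraticFields (BinaryQuadraticForm.classNumber)
open Literature.NumberTheory.QuadraticFields.BinaryQuadraticForm (assignedCharCount)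
open Literature.NumberTheory.QuadraticFields.Quadratic
open Literature.NumberTheory.QuadraticFields.Quadratic.BinQF (mem_span_pair_iff)
open Literature.Computability.Cryptography.Hallgren2005.OrderCl (NegDiscr)
open Literature.Computability.Cryptography.Hallgren2005.FormComposition (one isPosPrim_one)

/-! ### §1 A common square root of `m` (card §7, Step 1) -/

/-- **Bezout makes `m` a square modulo a primitive norm, explicitly**: if `a·(x² − m y²) + b·y = 1` then
`(x b)² − m = (x² − m y²)·(b² − m a (y b + 1))`. [kernel] -/
theorem root_identity (m x y a b : ℤ) (h : a * (x ^ 2 - m * y ^ 2) + b * y = 1) :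
    (x * b) ^ 2 - m = (x ^ 2 - m * y ^ 2) * (b ^ 2 - m * a * (y * b + 1)) := by
  linear_combination (m * (y * b + 1)) * h

/-- For a primitive pair `(x, y)` the norm `x² − m y²` is prime to `y`. [kernel] -/
theorem isCoprime_norm_im (m : ℤ) {x y : ℤ} (h : IsCoprime x y) : IsCoprime (x ^ 2 - m * y ^ 2) y := by
  have h2 : IsCoprime (x ^ 2 + y * (-(m * y))) y := (IsCoprime.pow_left (m := 2) h).add_mul_left_left _
  have e : x ^ 2 + y * (-(m * y)) = x ^ 2 - m * y ^ 2 := by ring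
  rwa [e] at h2

/-- **Step 1, one modulus**: a PRIMITIVE representation `n = x² − m y²` (`gcd(x, y) = 1`) yields `A` with `n ∣ A² − m`
(namely `A = x·b` for a Bezout pair `a n + b y = 1`). [kernel] -/
theorem exists_root_of_primitive_rep (m : ℤ) {x y : ℤ} (h : IsCoprime x y) :
    ∃ A : ℤ, x ^ 2 - m * y ^ 2 ∣ A ^ 2 - m := by
  obtain ⟨a, b, hab⟩ := isCoprime_norm_im m h
  exact ⟨x * b, Dvd.intro _ (root_identity m x y a b hab).symm⟩

/-- CRT for a pair of coprime moduli (Bezout form): some `A` is `≡ A₁ (mod n₁)` and `≡ A₂ (mod n₂)`. [kernel] -/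
theorem crt_pair {n₁ n₂ : ℤ} (h : IsCoprime n₁ n₂) (A₁ A₂ : ℤ) : ∃ A : ℤ, n₁ ∣ A - A₁ ∧ n₂ ∣ A - A₂ := by
  obtain ⟨u, v, huv⟩ := h
  exact ⟨A₂ * u * n₁ + A₁ * v * n₂, ⟨u * (A₂ - A₁), by linear_combination A₁ * huv⟩,
    ⟨v * (A₁ - A₂), by linear_combination A₂ * huv⟩⟩

/-- A root of `m` modulo `n` stays a root when moved within its residue class: `n ∣ A − A₁`, `n ∣ A₁² − m ⇒ n ∣ A² − m`. [kernel] -/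
theorem root_of_congr {m n A A₁ : ℤ} (hA : n ∣ A - A₁) (h1 : n ∣ A₁ ^ 2 - m) : n ∣ A ^ 2 - m := by
  have e : A ^ 2 - m = (A - A₁) * (A + A₁) + (A₁ ^ 2 - m) := by ring
  rw [e]; exact dvd_add (dvd_mul_of_dvd_left hA _) h1

/-- **Step 1, gluing (CRT) for COPRIME moduli**: roots of `m` modulo coprime `n₁, n₂` glue to a root modulo `n₁ n₂` congruent
to each. (For moduli sharing primes the card's proof refines to prime powers; not here.) [kernel] -/
theorem root_glue {m n₁ n₂ A₁ A₂ : ℤ} (h : IsCoprime n₁ n₂) (h1 : n₁ ∣ A₁ ^ 2 - m) (h2 : n₂ ∣ A₂ ^ 2 - m) :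
    ∃ A : ℤ, n₁ ∣ A - A₁ ∧ n₂ ∣ A - A₂ ∧ n₁ * n₂ ∣ A ^ 2 - m := by
  obtain ⟨A, d1, d2⟩ := crt_pair h A₁ A₂
  exact ⟨A, d1, d2, IsCoprime.mul_dvd h (root_of_congr d1 h1) (root_of_congr d2 h2)⟩

/-- **Element-level gluing for coprime norms**: if `z₁ ∣ A₁ − l`, `z₂ ∣ A₂ − l` in `ℤ√m` and `zᵢ ∣ nᵢ` with `n₁, n₂` coprime
integers (e.g. `nᵢ = N zᵢ`), then `z₁, z₂` divide a COMMON `A − l`. (So the class group couples the weights of a line only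
through shared primes of the `T∕c_j`.) [kernel] -/
theorem common_A_of_coprime {m n₁ n₂ A₁ A₂ : ℤ} {z₁ z₂ : ℤ√m} (h : IsCoprime n₁ n₂)
    (hz1 : z₁ ∣ (n₁ : ℤ√m)) (hz2 : z₂ ∣ (n₂ : ℤ√m))
    (h1 : z₁ ∣ (⟨A₁, -1⟩ : ℤ√m)) (h2 : z₂ ∣ (⟨A₂, -1⟩ : ℤ√m)) :
    ∃ A : ℤ, z₁ ∣ (⟨A, -1⟩ : ℤ√m) ∧ z₂ ∣ (⟨A, -1⟩ : ℤ√m) := by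
  obtain ⟨A, ⟨k₁, hk₁⟩, ⟨k₂, hk₂⟩⟩ := crt_pair h A₁ A₂
  refine ⟨A, ?_, ?_⟩
  · have e : (⟨A, -1⟩ : ℤ√m) = ⟨A₁, -1⟩ + (n₁ : ℤ√m) * (k₁ : ℤ√m) := by
      ext
      · simp [Zsqrtd.re_add, Zsqrtd.re_mul]; linarith
      · simp [Zsqrtd.im_add, Zsqrtd.im_mul]
    rw [e]; exact dvd_add h1 (dvd_mul_of_dvd_left hz1 _)
  · have e : (⟨A, -1⟩ : ℤ√m) = ⟨A₂, -1⟩ + (n₂ : ℤ√m) * (k₂ : ℤ√m) := by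
      ext
      · simp [Zsqrtd.re_add, Zsqrtd.re_mul]; linarith
      · simp [Zsqrtd.im_add, Zsqrtd.im_mul]
    rw [e]; exact dvd_add h2 (dvd_mul_of_dvd_left hz2 _)

/-! ### §2 The ideal `𝔞_n(A) = (n, −A + l)` and the PROPOSITION of card §11 -/

/-- Coordinates of a divisor of `A − l`: if `z·w = ⟨A, −1⟩` then `Re z + A·Im z = −Im w · N z`. [kernel] -/
theorem re_add_mul_im_of_dvd {m A : ℤ} {z w : ℤ√m} (h : z * w = ⟨A, -1⟩) :
    z.re + A * z.im = -w.im * z.norm := by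
  have hre : z.re * w.re + m * z.im * w.im = A := by simpa [Zsqrtd.re_mul] using congrArg Zsqrtd.re h
  have him : z.re * w.im + z.im * w.re = -1 := by simpa [Zsqrtd.im_mul] using congrArg Zsqrtd.im h
  rw [Zsqrtd.norm_def]
  linear_combination (-z.im) * hre + z.re * him

/-- **A divisor of `A − l` is primitive** (`gcd(Re z, Im z) = 1`, from the `l`-component of `z·w = A − l`). [kernel] -/
theorem isCoprime_of_dvd {m A : ℤ} {z w : ℤ√m} (h : z * w = ⟨A, -1⟩) : IsCoprime z.re z.im := by
  have him : z.re * w.im + z.im * w.re = -1 := by simpa [Zsqrtd.im_mul] using congrArg Zsqrtd.im h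
  exact ⟨-w.im, -w.re, by linear_combination -him⟩

/-- Norm of an element of `𝔞_n(A)`: if `A² − n c = m` and `Re z + A·Im z = n k` then
`N z = n·(n k² − 2 k A·Im z + c·(Im z)²)`; in particular `n ∣ N z`. [kernel] -/
theorem norm_eq_of_mem {m n c A : ℤ} (hc : A ^ 2 - n * c = m) {z : ℤ√m} {k : ℤ} (hk : z.re + A * z.im = n * k) :
    z.norm = n * (n * k ^ 2 - 2 * k * A * z.im + c * z.im ^ 2) := by
  rw [Zsqrtd.norm_def]
  have e : z.re = n * k - A * z.im := by linarith
  rw [e]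
  linear_combination (z.im ^ 2) * hc

/-- **§11 PROPOSITION (⇒)**: if `𝔞_n(A) = (n, −A + l)` (with `n ≠ 0`, `A² − n c = m`) is the principal ideal `(z)`, then
`z ∣ A − l` and `N z = ±n`. (Proof: `z ∣ n` and `n ∣ N z` give `N z = n s`, `n·z̄ = N z·t`, so `z̄ = s·t` coordinatewise; `z` is
primitive as a divisor of `A − l`, hence `s = ±1`.) [kernel] -/
theorem dvd_and_norm_of_span_eq {m n c A : ℤ} (hn : n ≠ 0) (hc : A ^ 2 - n * c = m) {z : ℤ√m}
    (h : Ideal.span {(n : ℤ√m), ⟨-A, 1⟩} = Ideal.span {z}) :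
    z ∣ (⟨A, -1⟩ : ℤ√m) ∧ (z.norm = n ∨ z.norm = -n) := by
  have h1 : (⟨-A, 1⟩ : ℤ√m) ∈ Ideal.span {z} := h ▸ Ideal.subset_span (by simp)
  have h2 : ((n : ℤ) : ℤ√m) ∈ Ideal.span {z} := h ▸ Ideal.subset_span (by simp)
  have h3 : z ∈ Ideal.span {(n : ℤ√m), ⟨-A, 1⟩} := h ▸ Ideal.mem_span_singleton_self z
  rw [Ideal.mem_span_singleton] at h1 h2
  have hdvd : z ∣ (⟨A, -1⟩ : ℤ√m) := by
    have e : (⟨A, -1⟩ : ℤ√m) = -⟨-A, 1⟩ := by ext <;> simp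
    rw [e]; exact (dvd_neg).2 h1
  refine ⟨hdvd, ?_⟩
  obtain ⟨w, hw⟩ := hdvd
  obtain ⟨t, ht⟩ := h2
  obtain ⟨k, hk⟩ := (mem_span_pair_iff hc z).1 h3
  have hnorm := norm_eq_of_mem hc hk
  set s : ℤ := n * k ^ 2 - 2 * k * A * z.im + c * z.im ^ 2 with hs
  have key : ((n : ℤ) : ℤ√m) * star z = (z.norm : ℤ√m) * t := by
    rw [Zsqrtd.norm_eq_mul_conj, ht]; ring
  have kre := congrArg Zsqrtd.re key
  have kim := congrArg Zsqrtd.im key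
  simp only [Zsqrtd.re_mul, Zsqrtd.im_mul, Zsqrtd.re_intCast, Zsqrtd.im_intCast, Zsqrtd.re_star,
    Zsqrtd.im_star, mul_zero, zero_mul, add_zero, hnorm] at kre kim
  have e1 : z.re = s * t.re := by
    have : n * (z.re - s * t.re) = 0 := by linear_combination kre
    rcases mul_eq_zero.1 this with h0 | h0
    · exact absurd h0 hn
    · linarith
  have e2 : z.im = -(s * t.im) := by
    have : n * (z.im + s * t.im) = 0 := by linear_combination -kim
    rcases mul_eq_zero.1 this with h0 | h0
    · exact absurd h0 hn
    · linarith
  obtain ⟨u, v, huv⟩ := isCoprime_of_dvd hw.symm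
  have hs1 : s ∣ 1 := ⟨u * t.re - v * t.im, by rw [← huv, e1, e2]; ring⟩
  rcases Int.isUnit_iff.1 (isUnit_of_dvd_one hs1) with h0 | h0
  · left; rw [hnorm, h0, mul_one]
  · right; rw [hnorm, h0, mul_neg, mul_one]

/-- **§11 PROPOSITION (⇐)**: if `z ∣ A − l` and `N z = ±n` (`A² − n c = m`) then `(n, −A + l) = (z)`. [kernel] -/
theorem span_eq_of_dvd_of_norm {m n c A : ℤ} (hc : A ^ 2 - n * c = m) {z : ℤ√m}
    (hdvd : z ∣ (⟨A, -1⟩ : ℤ√m)) (hnorm : z.norm = n ∨ z.norm = -n) :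
    Ideal.span {(n : ℤ√m), ⟨-A, 1⟩} = Ideal.span {z} := by
  obtain ⟨w, hw⟩ := hdvd
  have hzn : z ∣ (z.norm : ℤ√m) := ⟨star z, Zsqrtd.norm_eq_mul_conj z⟩
  apply le_antisymm
  · rw [Ideal.span_le]
    intro x hx
    simp only [Set.mem_insert_iff, Set.mem_singleton_iff] at hx
    rw [SetLike.mem_coe, Ideal.mem_span_singleton]
    rcases hx with rfl | rfl
    · rcases hnorm with h | h
      · rw [← h]; exact hzn
      · have e : ((n : ℤ) : ℤ√m) = -(z.norm : ℤ√m) := by rw [h]; push_cast; ring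
        rw [e]; exact (dvd_neg).2 hzn
    · have e : (⟨-A, 1⟩ : ℤ√m) = -(z * w) := by rw [← hw]; ext <;> simp
      rw [e]; exact (dvd_neg).2 (dvd_mul_right z w)
  · rw [Ideal.span_singleton_le_iff_mem]
    apply (mem_span_pair_iff hc z).2
    have e := re_add_mul_im_of_dvd hw.symm
    rcases hnorm with h | h
    · exact ⟨-w.im, by rw [e, h]; ring⟩
    · exact ⟨w.im, by rw [e, h]; ring⟩

/-- **§11 PROPOSITION (the «iff»)**: for `n ≠ 0`, `A² − n c = m`: `(n, −A + l) = (z)` ⟺ `z ∣ A − l ∧ N z = ±n`.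
By value (card §11): this turns «the line `(c_j)` is reached at `(T, A)`» into «every `𝔞_{T∕c_j}(A)` is principal» — a condition
in `Pic(ℤ[√m])` (narrow classes for `m > 0`, where the sign of `N z` matters and is not decided here). [kernel] -/
theorem span_eq_iff {m n c A : ℤ} (hn : n ≠ 0) (hc : A ^ 2 - n * c = m) (z : ℤ√m) :
    Ideal.span {(n : ℤ√m), ⟨-A, 1⟩} = Ideal.span {z} ↔
      z ∣ (⟨A, -1⟩ : ℤ√m) ∧ (z.norm = n ∨ z.norm = -n) :=
  ⟨dvd_and_norm_of_span_eq hn hc, fun h => span_eq_of_dvd_of_norm hc h.1 h.2⟩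

/-- Descent of principality from the fraction field: if the fractional ideal of an integral ideal `J` of a domain is a
principal submodule, then `J = (x)` for some `x ∈ R`. [kernel] -/
theorem exists_span_singleton_of_coe_isPrincipal {R K : Type*} [CommRing R] [IsDomain R] [Field K] [Algebra R K]
    [IsFractionRing R K] (J : Ideal R)
    (h : ((J : FractionalIdeal R⁰ K) : Submodule R K).IsPrincipal) : ∃ x : R, J = Ideal.span {x} := by
  haveI := h
  set g := Submodule.IsPrincipal.generator ((J : FractionalIdeal R⁰ K) : Submodule R K) with hg
  have hgmem : g ∈ ((J : FractionalIdeal R⁰ K) : Submodule R K) := Submodule.IsPrincipal.generator_mem _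
  rw [FractionalIdeal.mem_coe, FractionalIdeal.mem_coeIdeal] at hgmem
  obtain ⟨x, hxJ, hx⟩ := hgmem
  refine ⟨x, le_antisymm ?_ ((Ideal.span_singleton_le_iff_mem _).2 hxJ)⟩
  intro y hy
  have hy' : algebraMap R K y ∈ ((J : FractionalIdeal R⁰ K) : Submodule R K) := by
    rw [FractionalIdeal.mem_coe, FractionalIdeal.mem_coeIdeal]; exact ⟨y, hy, rfl⟩
  obtain ⟨r, hr⟩ := (Submodule.IsPrincipal.mem_iff_eq_smul_generator _).1 hy'
  rw [Ideal.mem_span_singleton]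
  refine ⟨r, IsFractionRing.injective R K ?_⟩
  rw [hr, ← hg, ← hx, map_mul, Algebra.smul_def, mul_comm]

/-! ### §3 The capture (card §7 Steps 2–4) for `m < 0` and `n` prime to `4m` -/

/-- The form of the ideal `𝔞_n(A)`: `f = (n, 2A, c)` with `A² − n c = m` is primitive positive definite of discriminant `4m`
when `n > 0` is prime to `4m` (a common divisor of `n` and `2A` divides `4m = (2A)² − 4nc`). [kernel] -/
theorem lineForm_isPosPrim {m n c A : ℤ} (hn : 0 < n) (hc : A ^ 2 - n * c = m) (hcop : IsCoprime n (4 * m)) :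
    (⟨n, 2 * A, c⟩ : BinQF).IsPosPrim (4 * m) := by
  refine ⟨?_, hn, ?_⟩
  · simp only [BinQF.disc]; linear_combination 4 * hc
  · rw [BinQF.isPrimitive_iff]
    intro d hd1 hd2 _
    obtain ⟨u, v, huv⟩ := hcop
    have h4m : d ∣ 4 * m := by
      have e : 4 * m = (2 * A) * (2 * A) - 4 * c * n := by rw [← hc]; ring
      rw [e]; exact dvd_sub (dvd_mul_of_dvd_left hd2 _) (dvd_mul_of_dvd_right hd1 _)
    exact isUnit_of_dvd_one (by rw [← huv]; exact dvd_add (dvd_mul_of_dvd_right hd1 _) (dvd_mul_of_dvd_right h4m _))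

/-- The principal form of discriminant `4m` is `x² − m y²` (`one (4m) = (1, 0, −m)`). [kernel] -/
theorem one_four_mul (m : ℤ) : one (4 * m) = ⟨1, 0, -m⟩ := by
  rw [one_eq_of_emod_four_eq_zero (by omega : (4 * m) % 4 = 0)]
  congr 1; omega

/-- … and it is the `principalForm m` of `ZsqrtdFormClassGroup`. [kernel] -/
theorem one_four_mul_eq_principalForm (m : ℤ) : one (4 * m) = BinQF.principalForm m := by
  rw [one_four_mul]; rfl

/-- The ideal of the form `(n, 2A, c)` in `ℤ√m` is `𝔞_n(A) = (n, −A + l)`. [kernel] -/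
theorem ideal_lineForm (m n c A : ℤ) : BinQF.ideal m ⟨n, 2 * A, c⟩ = Ideal.span {(n : ℤ√m), ⟨-A, 1⟩} := by
  simp [BinQF.ideal]

/-- **The form of `𝔞_n(A)` lies in the PRINCIPAL GENUS** when `n` (prime to `4m`, `m < 0`) is a value of the principal form
`x² − m y²`: both forms represent the unit `n` of `ℤ∕4m`, and a value determines the genus (Cox Lemma 2.24 (ii), tree). [kernel] -/
theorem lineForm_genus_eq_one {m n c A x y : ℤ} (hm : m < 0) (hn : 0 < n) (hc : A ^ 2 - n * c = m)
    (hcop : IsCoprime n (4 * m)) (hrep : x ^ 2 - m * y ^ 2 = n) :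
    (⟨n, 2 * A, c⟩ : BinQF).genus (4 * m) = 1 := by
  have hD : 4 * m < 0 := by omega
  have hD4 : (4 * m) % 4 = 0 ∨ (4 * m) % 4 = 1 := Or.inl (by omega)
  have hcoe : ((unitOfIsCoprime hcop : (ZMod (4 * m).natAbs)ˣ) : ZMod (4 * m).natAbs) = (n : ZMod (4 * m).natAbs) := rfl
  have h1 : (⟨n, 2 * A, c⟩ : BinQF).genus (4 * m) = (unitOfIsCoprime hcop : (ZMod (4 * m).natAbs)ˣ ⧸ principalValues (4 * m)) :=
    BinQF.genus_eq_mk hD (lineForm_isPosPrim hn hc hcop) (BinQF.mem_valueSet_of_eq_a hcoe.symm)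
  have h2 : (one (4 * m)).genus (4 * m) = (unitOfIsCoprime hcop : (ZMod (4 * m).natAbs)ˣ ⧸ principalValues (4 * m)) := by
    apply BinQF.genus_eq_mk hD (isPosPrim_one hD hD4).1
    refine ⟨x, y, ?_⟩
    rw [one_four_mul, hcoe, ← hrep]
    simp only [BinQF.eval]
    push_cast; ring
  rw [h1, ← h2, genus_one hD hD4]

/-- **PRINCIPAL-GENUS CAPTURE, one class per genus stated on forms** (Cox Thm. 3.22 (i): any two primitive positive definite
forms of discriminant `4m` in the same genus are properly equivalent). For `m < 0`, `n > 0` prime to `4m` and a value of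
`x² − m y²`, and ANY `A` with `n ∣ A² − m` (`A² − n c = m`): some `z ∈ ℤ√m` with `N z = n` divides `A − l`, and `z` is primitive.
Route: the form `(n, 2A, c)` is in the principal genus (`lineForm_genus_eq_one`) ⇒ properly equivalent to `one (4m)` ⇒ same ideal
class in `ClassGroup (ℤ√m)` (Cox Thm. 7.7 (ii), tree `toClass_eq_of_properEquiv`) = `1` ⇒ `𝔞_n(A)` principal ⇒ §2. [kernel] -/
theorem capture_of_forall_genus {m : ℤ} (hm : m < 0)
    (H : ∀ f g : BinQF, f.IsPosPrim (4 * m) → g.IsPosPrim (4 * m) → f.genus (4 * m) = g.genus (4 * m) → f.ProperEquiv g)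
    {n c A x y : ℤ} (hn : 0 < n) (hc : A ^ 2 - n * c = m) (hcop : IsCoprime n (4 * m)) (hrep : x ^ 2 - m * y ^ 2 = n) :
    ∃ z : ℤ√m, z.norm = n ∧ z ∣ (⟨A, -1⟩ : ℤ√m) ∧ IsCoprime z.re z.im := by
  haveI : IsDomain (ℤ√m) := Zsqrtd.isDomain_of_neg hm
  have hD : 4 * m < 0 := by omega
  have hD4 : (4 * m) % 4 = 0 ∨ (4 * m) % 4 = 1 := Or.inl (by omega)
  have hf := lineForm_isPosPrim hn hc hcop
  have hpe : (⟨n, 2 * A, c⟩ : BinQF).ProperEquiv (one (4 * m)) :=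
    H _ _ hf (isPosPrim_one hD hD4).1 (by rw [lineForm_genus_eq_one hm hn hc hcop hrep, genus_one hD hD4])
  have hcl : BinQF.toClass m ⟨n, 2 * A, c⟩ = 1 := by
    rw [BinQF.toClass_eq_of_properEquiv hm hf hpe, one_four_mul_eq_principalForm, BinQF.toClass_principalForm]
  have hu := BinQF.isUnit_fracIdeal_of_isPosPrim hf
  rw [BinQF.toClass_of_isUnit hu] at hcl
  have hP := ClassGroup.mk_eq_one_iff.1 hcl
  rw [hu.unit_spec] at hP
  obtain ⟨z, hz⟩ := exists_span_singleton_of_coe_isPrincipal (K := FractionRing (ℤ√m)) (BinQF.ideal m ⟨n, 2 * A, c⟩) hP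
  rw [ideal_lineForm] at hz
  obtain ⟨hdvd, hnorm⟩ := dvd_and_norm_of_span_eq hn.ne' hc hz
  have h0 := Zsqrtd.norm_nonneg hm.le z
  refine ⟨z, ?_, hdvd, ?_⟩
  · rcases hnorm with h | h
    · exact h
    · omega
  · obtain ⟨w, hw⟩ := hdvd
    exact isCoprime_of_dvd hw.symm

/-- **PRINCIPAL-GENUS CAPTURE under the printed class-number criterion** `h(4m) = 2^{μ−1}` («one class per genus», Cox Thm. 3.22
(v); `μ = assignedCharCount (4m)`), for `m < 0`: if `n > 0` is prime to `4m`, is a value of `x² − m y²`, and `n ∣ A² − m`, then some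
primitive `z ∈ ℤ[√m]` of norm `n` divides `A − l`. This is Steps 2–4 of card §7 (and, for `m ≡ 1 (4)`, of §10 at odd `n`) in the
coprime-to-`4m` case; Step 1 (existence of `A` for a whole line) is §1. [kernel] -/
theorem capture {m : ℤ} (hm : m < 0)
    (hh : BinaryQuadraticForm.classNumber (4 * m) = 2 ^ (assignedCharCount (4 * m) - 1))
    {n c A x y : ℤ} (hn : 0 < n) (hc : A ^ 2 - n * c = m) (hcop : IsCoprime n (4 * m)) (hrep : x ^ 2 - m * y ^ 2 = n) :
    ∃ z : ℤ√m, z.norm = n ∧ z ∣ (⟨A, -1⟩ : ℤ√m) ∧ IsCoprime z.re z.im := by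
  let Δ : NegDiscr := ⟨4 * m, by omega⟩
  have hD4 : Δ.D % 4 = 0 ∨ Δ.D % 4 = 1 := Or.inl (show (4 * m) % 4 = 0 by omega)
  have hsq := (forall_sq_eq_one_iff_classNumber_eq Δ hD4).2 hh
  exact capture_of_forall_genus hm ((forall_genus_eq_imp_properEquiv_iff_forall_sq_eq_one Δ hD4).2 hsq) hn hc hcop hrep

/-- **PRINCIPAL-GENUS CAPTURE under the decidable test of Cox Thm. 3.22 (ii)**: every reduced form `(a, b, c)` of discriminant `4m` is
ambiguous (`b = 0`, `b = a` or `a = c`) — checkable by the kernel on the tree's `reducedFormsList` — implies the capture. [kernel] -/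
theorem capture_of_forall_ambiguous {m : ℤ} (hm : m < 0)
    (h : ∀ g ∈ BinQF.reducedFormsList (4 * m), g.b = 0 ∨ g.b = g.a ∨ g.a = g.c)
    {n c A x y : ℤ} (hn : 0 < n) (hc : A ^ 2 - n * c = m) (hcop : IsCoprime n (4 * m)) (hrep : x ^ 2 - m * y ^ 2 = n) :
    ∃ z : ℤ√m, z.norm = n ∧ z ∣ (⟨A, -1⟩ : ℤ√m) ∧ IsCoprime z.re z.im := by
  let Δ : NegDiscr := ⟨4 * m, by omega⟩
  have hD4 : Δ.D % 4 = 0 ∨ Δ.D % 4 = 1 := Or.inl (show (4 * m) % 4 = 0 by omega)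
  have hsq := (forall_ambiguous_iff_forall_sq_eq_one Δ hD4).1 h
  exact capture_of_forall_genus hm ((forall_genus_eq_imp_properEquiv_iff_forall_sq_eq_one Δ hD4).2 hsq) hn hc hcop hrep

/-- **Gauss's check on Euler's table, as the capture needs it**: for each of Euler's 65 convenient numbers `k` (tree
`eulerConvenientNumbers`: 1, 2, 3, 4, 5, 6, 7, 8, 9, 10, 12, 13, 15, …, 1848) every reduced form of discriminant `−4k` is ambiguous —
one class per genus for `ℤ[√−k]` (the kernel evaluates the tree's `reducedFormsList`, as in `isConvenientNumber_of_mem_eulerConvenientNumbers`).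
[kernel] -/
theorem euler_forall_ambiguous :
    ∀ k ∈ eulerConvenientNumbers, 0 < k ∧ ∀ g ∈ BinQF.reducedFormsList (-4 * (k : ℤ)), g.b = 0 ∨ g.b = g.a ∨ g.a = g.c := by
  decide +kernel

/-- **PRINCIPAL-GENUS CAPTURE for all 65 of Euler's convenient numbers** — in particular for EVERY imaginary one-class-per-genus node
field of the LINE-LAW census (`m = −1, −2, −3, −5, −6, −7, −10, −13, −15, −21, −22, −30, −33, −37, −42, −57, −58`): for `k` in Euler's list,
`n > 0` prime to `4k` with `n = x² + k y²` and `n ∣ A² + k`, some primitive `z ∈ ℤ[√−k]` of norm `n` divides `A − √−k`. [kernel] -/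
theorem capture_euler {k : ℕ} (hk : k ∈ eulerConvenientNumbers) {n c A x y : ℤ} (hn : 0 < n)
    (hc : A ^ 2 - n * c = -(k : ℤ)) (hcop : IsCoprime n (4 * (k : ℤ))) (hrep : x ^ 2 + (k : ℤ) * y ^ 2 = n) :
    ∃ z : ℤ√(-(k : ℤ)), z.norm = n ∧ z ∣ (⟨A, -1⟩ : ℤ√(-(k : ℤ))) ∧ IsCoprime z.re z.im := by
  obtain ⟨hk0, h⟩ := euler_forall_ambiguous k hk
  rw [show (-4 * (k : ℤ)) = 4 * (-(k : ℤ)) by ring] at h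
  have hcop' : IsCoprime n (4 * (-(k : ℤ))) := by rw [show 4 * (-(k : ℤ)) = -(4 * (k : ℤ)) by ring]; exact hcop.neg_right
  have hrep' : x ^ 2 - (-(k : ℤ)) * y ^ 2 = n := by linear_combination hrep
  exact capture_of_forall_ambiguous (by omega) h hn hc hcop' hrep'

/-- **A whole weight line at once** (the shape THEOREM CF⁶ consumes): given ONE `A` with `n_j ∣ A² − m` for every weight index
`j` (each `n_j > 0` prime to `4m` and a value of `x² − m y²`), every `j` gets a primitive `z_j` with `N z_j = n_j`, `z_j ∣ A − l` —
the SAME `A` for all `j`: under one class per genus there is no coupling between the weights beyond the existence of `A`. [kernel] -/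
theorem line_capture {m : ℤ} (hm : m < 0)
    (hh : BinaryQuadraticForm.classNumber (4 * m) = 2 ^ (assignedCharCount (4 * m) - 1))
    {ι : Type*} (nj cj xj yj : ι → ℤ) (A : ℤ) (hn : ∀ j, 0 < nj j) (hc : ∀ j, A ^ 2 - nj j * cj j = m)
    (hcop : ∀ j, IsCoprime (nj j) (4 * m)) (hrep : ∀ j, xj j ^ 2 - m * yj j ^ 2 = nj j) :
    ∀ j, ∃ z : ℤ√m, z.norm = nj j ∧ z ∣ (⟨A, -1⟩ : ℤ√m) ∧ IsCoprime z.re z.im :=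
  fun j => capture hm hh (hn j) (hc j) (hcop j) (hrep j)

/-- **Unconditional instance: the node field `ℚ(√−5)` of Q-16-2 ∕ OBSERVATION 16-4** (`ℤ[√−5]`, `h(−20) = 2 = 2^{μ−1}`, tree
`classNumber_neg_four_mul_five`): for `n > 0` prime to `20` with `n = x² + 5y²` and `n ∣ A² + 5`, some primitive `z ∈ ℤ[√−5]` of
norm `n` divides `A − √−5`. [kernel] -/
theorem capture_sqrt_neg_five {n c A x y : ℤ} (hn : 0 < n) (hc : A ^ 2 - n * c = -5) (hcop : IsCoprime n 20)
    (hrep : x ^ 2 + 5 * y ^ 2 = n) :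
    ∃ z : ℤ√(-5), z.norm = n ∧ z ∣ (⟨A, -1⟩ : ℤ√(-5)) ∧ IsCoprime z.re z.im := by
  have hh : BinaryQuadraticForm.classNumber (4 * (-5 : ℤ)) = 2 ^ (assignedCharCount (4 * (-5 : ℤ)) - 1) := by
    have := classNumber_neg_four_mul_five
    norm_num at this ⊢
    exact this
  have hcop' : IsCoprime n (4 * (-5 : ℤ)) := by norm_num; exact hcop.neg_right
  have hrep' : x ^ 2 - (-5 : ℤ) * y ^ 2 = n := by linear_combination hrep
  exact capture (by norm_num) hh hn hc hcop' hrep'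

end Summit.Ventures.HSemireg.LineLawPrincipalGenus
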